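import Summits.BirchSwinnertonDyer.BirchSwinnertonDyer.Theorems.AlignedTransportAtTwoMainConjectureOfRankZeroBSDAtTwoHalfDescentLayerIndexFinite
import Summits.BirchSwinnertonDyer.BirchSwinnertonDyer.Theorems.AlignedTransportAtTwoMainConjectureOfRankZeroBSDAtTwoHalfDescentLayerIndexSelmer
import HarnessLib

/-!
# Route `AlignedTransportAtTwo`, crux C2 `MainConjectureOfRankZeroBSDAtTwo` (stmt-BirchSwinnertonDyer-22298):
# THE DESCENT NUMBER WITHOUT GREENBERG 4.14, IX — IWASAWA'S `ν` IN INDEX FORM: a finite `Λ`-module `F` is killed by `ω_n` for `n ≫ 0`, and `Ψ_n ≡ p (mod ω_n)`,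
# so `#(F/Ψ_n F) = #(F/pF)` eventually; hence for EVERY finitely generated torsion `X` with `char_Λ X = (f)` and largest finite submodule `F`:
# `#(X/Ψ_n X) = p^{pⁿ(p−1)μ(f) + λ(f)} · #(F/pF)` for all `n ≫ 0` — for `μ = 0` the descent numbers are EVENTUALLY CONSTANT, with stable value `p^{λ}·#(F/pF)`

HONEST FRAMING (cell `bsd-f1-sign2`, WIDTH-5 attached prover seat `bsd-line-att-p5` gen 55 on line `birth` of the lead `bsd-line-att-p2`;
`--supports` stmt-BirchSwinnertonDyer-22298, closes nothing; BSD is NOT proved by any of this; the crux C2, its verdict «blocked-on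
`Rank1Residual.GreenbergMuConjectureIrreducible`» and every registered stub (P / T / Kμ / LimDoor / MuIneqʳ / PFμ⁺) are untouched). THEOREMS ONLY — no `def`,
no instance, no named fact, no `sorry`; route-independent. Sequel of this gen's `…HalfDescentLayerIndexFinite` (★★★ `natCard_layerQuotient_eq_pow_mul`:
`#(X/Ψ_nX) = p^{φμ+λ}·#(F/Ψ_nF)`) and g54's `…LayerIndexSelmer` (Selmer currency, `#(X/Ψ_nX) = #ker(N_n | Sel_∞)`). g54 made Iwasawa's `e_n = μpⁿ + λn + ν` exact for modules WITHOUT finite submodule; here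
is the finite submodule's contribution to ONE LAYER: `#(F/Ψ_nF)`, which STABILISES at `#(F/pF)` (NOT at `#F`: the layer index and the growth `e_{n+1} − e_n` differ
when `F ≠ 0`, since `ω_n` is then not `X`-regular).

* §1 (any finite `Λ`-module `N`) `exists_maximalIdeal_pow_smul_top_eq_bot` (`𝔪^k N = 0` for some `k`: the chain `𝔪^k N` is eventually stationary in the finite
  lattice of submodules, then Nakayama); `omega_mem_maximalIdeal_pow` (`ω_n ∈ 𝔪^{n+1}`, as `ω_{n+1} = Ψ_n ω_n`, `Ψ_n, T ∈ 𝔪`); ★ `exists_forall_omega_smul_eq_zero`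
  (**`ω_n N = 0` for all `n ≥ n₁`**); `coe_cyclotomicLayer_sub_C_mem_span_omega` (**`Ψ_n − p ∈ (ω_n)`**: `Ψ_n = ∑_{i<p} u^i`, `u = (1+T)^{pⁿ}`, `u − 1 = ω_n ∣ u^i − 1`);
  ★★ `exists_forall_natCard_quotient_cyclotomicLayer_eq` (**`#(N/Ψ_nN) = #(N/pN)` for all `n ≥ n₁`**).
* §2 (`X` ANY f.g. torsion, `char_Λ X = (f)`, `F ≤ X` finite with `X/F` free of finite submodules) ★★★ **`exists_forall_natCard_layerQuotient_eq_pow_mul_natCard_quotient_p`: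
  `∃ n₁, ∀ n ≥ n₁, #(X/Ψ_nX) = p^{pⁿ(p−1)μ(f) + λ(f)} · #(F/pF)`**; ★★ `exists_forall_natCard_layerQuotient_eq_of_mu_eq_zero` (`μ = 0`: **the descent numbers are
  EVENTUALLY CONSTANT, `= p^{λ(f)}·#(F/pF)`**); Selmer form ★★ `exists_forall_natCard_endInvariants_relNorm_eq_of_mu_eq_zero` (`#ker(N_n | Sel_∞) = p^{λ}·#(F/pF)` for
  `n ≥ n₁`).
Reading for C2 (`p = 2`, `μ_an = 0` anchors): if MC holds at the datum, the relative-norm kernels `#ker((1+conj_γ^{2ⁿ}) | Sel_{2^∞}(W/ℚ_∞))` are `2^{λ_an}·#(F/Ψ_nF)`,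
non-decreasing to the STABLE VALUE `2^{λ_an + d}`, `d = dim_{𝔽₂} F/2F` (`F` the largest finite submodule of `X(W/ℚ_∞)`, `= 0` under Greenberg 4.14/4.15); a
certificate layer (file VII) exists at the latest at `n = λ_an + #F`. Nothing is computed for any curve. Memo `Cruxes/MainConjectureOfRankZeroBSDAtTwo/LAYER-INDEX-FINITE-att-p5-g55.md`.

References: L. Washington, GTM 83, §13.2 (Nakayama, Lemma 13.16), §13.3 (Thm. 13.13: `ν`) [Washington1997]; J. Neukirch, A. Schmidt, K. Wingberg, (5.1.4) Remark 4,
(5.3.17) [NeukirchSchmidtWingberg2008]; R. Greenberg, LNM 1716 (1999), §1 p. 65, Prop. 4.14–4.15 [GreenbergLNM1716].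
-/

set_option linter.dupNamespace false
set_option autoImplicit false

noncomputable section

open scoped Classical AddSubgroup Polynomial

universe u v

namespace Summit.BirchSwinnertonDyer.BirchSwinnertonDyer.Theorems.AlignedTransportAtTwoHalfDescentLayerIndexEventual

open WeierstrassCurve Literature.NumberTheory.EllipticCurves Literature.NumberTheory.EllipticCurves.IwasawaDual
  Literature.NumberTheory.EllipticCurves.IwasawaAlgebra
  Summit.BirchSwinnertonDyer.Rank1Residual.X1.MuLambda
  Summit.BirchSwinnertonDyer.Rank1Residual.Iwasawa
  Summit.BirchSwinnertonDyer.BirchSwinnertonDyer.Theorems.DefectPrime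
  Summit.BirchSwinnertonDyer.BirchSwinnertonDyer.Theorems.AlignedTransportAtTwoCyclotomicLayerPrime
  Summit.BirchSwinnertonDyer.BirchSwinnertonDyer.Theorems.AlignedTransportAtTwoHalfDescentLayerIndex
  Summit.BirchSwinnertonDyer.BirchSwinnertonDyer.Theorems.AlignedTransportAtTwoHalfDescentLayerIndexFinite
  Summit.BirchSwinnertonDyer.BirchSwinnertonDyer.Theorems.AlignedTransportAtTwoHalfDescentLayerIndexSelmer

/-! ## §1 Finite `Λ`-modules: `𝔪^k N = 0`, `ω_n N = 0` for `n ≫ 0`, `Ψ_n ≡ p (mod ω_n)`, `#(N/Ψ_nN) = #(N/pN)` eventually -/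

section FiniteModule

variable {p : ℕ} [hp : Fact p.Prime] {N : Type v} [AddCommGroup N] [Module (IwasawaAlgebra p) N]

/-- **A finite `Λ`-module is killed by a power of `𝔪 = (p, T)`**: the submodules `𝔪^k N` form a non-increasing chain in the FINITE lattice of submodules of `N`,
so `𝔪^k N = 𝔪^{k+1} N = 𝔪·(𝔪^k N)` for some `k`, and Nakayama (`𝔪` = Jacobson radical of the local ring `Λ`) gives `𝔪^k N = 0`.
[cite: NeukirchSchmidtWingberg2008, (5.1.4) Remark 4] [cite: Washington1997, §13.2 (Lemma 13.16)] -/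
theorem exists_maximalIdeal_pow_smul_top_eq_bot [Finite N] :
    ∃ k : ℕ, ((IsLocalRing.maximalIdeal (IwasawaAlgebra p)) ^ k • ⊤ : Submodule (IwasawaAlgebra p) N) = ⊥ := by
  haveI : Finite (Submodule (IwasawaAlgebra p) N) := Finite.of_injective (fun S : Submodule (IwasawaAlgebra p) N ↦ (S : Set N)) SetLike.coe_injective
  set c : ℕ → Submodule (IwasawaAlgebra p) N := fun k ↦ (IsLocalRing.maximalIdeal (IwasawaAlgebra p)) ^ k • ⊤ with hc
  have hanti : ∀ i j, i ≤ j → c j ≤ c i := fun i j hij ↦ Submodule.smul_mono_left (Ideal.pow_le_pow_right hij)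
  obtain ⟨i, j, hij, heq⟩ := Finite.exists_ne_map_eq_of_infinite c
  -- a stationary step `c (k+1) = c k`
  have hstep : ∃ k, c (k + 1) = c k := by
    rcases lt_or_gt_of_ne hij with h | h
    · exact ⟨i, le_antisymm (hanti _ _ (Nat.le_succ i)) (heq ▸ hanti _ _ (Nat.succ_le_of_lt h))⟩
    · exact ⟨j, le_antisymm (hanti _ _ (Nat.le_succ j)) (heq.symm ▸ hanti _ _ (Nat.succ_le_of_lt h))⟩
  obtain ⟨k, hk⟩ := hstep
  refine ⟨k, ?_⟩
  have hFG : (c k).FG := by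
    haveI : IsNoetherian (IwasawaAlgebra p) N := inferInstance
    exact IsNoetherian.noetherian _
  refine Submodule.eq_bot_of_le_smul_of_le_jacobson_bot (IsLocalRing.maximalIdeal (IwasawaAlgebra p)) (c k) hFG ?_ ?_
  · -- `c k = c (k+1) = 𝔪 • c k`
    have e : c (k + 1) = IsLocalRing.maximalIdeal (IwasawaAlgebra p) • c k := by
      simp only [hc, pow_succ', Submodule.mul_smul]
    rw [← e, hk]
  · rw [IsLocalRing.jacobson_eq_maximalIdeal ⊥ bot_ne_top]

/-- **`ω_n = (1+T)^{pⁿ} − 1 ∈ 𝔪^{n+1}`** (`ω_0 = T ∈ 𝔪`, `ω_{n+1} = Ψ_n·ω_n` with `Ψ_n` prime, hence a non-unit, hence in `𝔪`). [cite: Washington1997, §13.2] -/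
theorem omega_mem_maximalIdeal_pow (n : ℕ) :
    (((1 + PowerSeries.X : PowerSeries ℤ_[p]) ^ (p ^ n) - 1 : IwasawaAlgebra p)) ∈ (IsLocalRing.maximalIdeal (IwasawaAlgebra p)) ^ (n + 1) := by
  induction n with
  | zero =>
    simp only [pow_zero, pow_one, add_sub_cancel_left, zero_add]
    rw [IsLocalRing.mem_maximalIdeal, mem_nonunits_iff]
    intro hX
    have h := PowerSeries.isUnit_iff_constantCoeff.mp hX
    rw [PowerSeries.constantCoeff_X] at h
    exact not_isUnit_zero h
  | succ n ih =>
    rw [← coe_cyclotomicLayer_mul_omega p n, pow_succ']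
    exact Ideal.mul_mem_mul ((IsLocalRing.mem_maximalIdeal _).mpr (prime_coe_cyclotomic_comp p n).not_unit) ih

/-- ★ **A finite `Λ`-module is killed by `ω_n` for all `n ≫ 0`.** [cite: NeukirchSchmidtWingberg2008, (5.1.4) Remark 4] [cite: Washington1997, §13.2] -/
theorem exists_forall_omega_smul_eq_zero [Finite N] :
    ∃ n₁ : ℕ, ∀ n, n₁ ≤ n → ∀ x : N, (((1 + PowerSeries.X : PowerSeries ℤ_[p]) ^ (p ^ n) - 1 : IwasawaAlgebra p)) • x = 0 := by
  obtain ⟨k, hk⟩ := exists_maximalIdeal_pow_smul_top_eq_bot (p := p) (N := N)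
  refine ⟨k, fun n hn x ↦ ?_⟩
  have hmem : (((1 + PowerSeries.X : PowerSeries ℤ_[p]) ^ (p ^ n) - 1 : IwasawaAlgebra p)) ∈ (IsLocalRing.maximalIdeal (IwasawaAlgebra p)) ^ k :=
    Ideal.pow_le_pow_right (by omega) (omega_mem_maximalIdeal_pow n)
  have hx : (((1 + PowerSeries.X : PowerSeries ℤ_[p]) ^ (p ^ n) - 1 : IwasawaAlgebra p)) • x ∈
      ((IsLocalRing.maximalIdeal (IwasawaAlgebra p)) ^ k • ⊤ : Submodule (IwasawaAlgebra p) N) := Submodule.smul_mem_smul hmem Submodule.mem_top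
  rw [hk, Submodule.mem_bot] at hx
  exact hx

/-- **`Ψ_n ≡ p (mod ω_n)`**: `Ψ_n − p = ∑_{i<p} (u^i − 1)` with `u = (1+T)^{pⁿ}`, and `ω_n = u − 1 ∣ u^i − 1`. [cite: Washington1997, §13.2] -/
theorem coe_cyclotomicLayer_sub_C_mem_span_omega (n : ℕ) :
    (((Polynomial.cyclotomic (p ^ (n + 1)) ℤ_[p]).comp (Polynomial.X + 1) : ℤ_[p][X]) : IwasawaAlgebra p) - PowerSeries.C (p : ℤ_[p]) ∈
      Ideal.span {(((1 + PowerSeries.X : PowerSeries ℤ_[p]) ^ (p ^ n) - 1 : IwasawaAlgebra p))} := by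
  rw [coe_cyclotomicLayer_eq_sum p n, map_natCast]
  have e : (∑ i ∈ Finset.range p, ((1 + PowerSeries.X : PowerSeries ℤ_[p]) ^ p ^ n) ^ i) - (p : IwasawaAlgebra p) =
      ∑ i ∈ Finset.range p, (((1 + PowerSeries.X : PowerSeries ℤ_[p]) ^ p ^ n) ^ i - 1) := by
    rw [Finset.sum_sub_distrib, Finset.sum_const, Finset.card_range, nsmul_eq_mul, mul_one]
  rw [e]
  exact Ideal.sum_mem _ fun i _ ↦ Ideal.mem_span_singleton.mpr (sub_one_dvd_pow_sub_one _ i)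

/-- ★★ **`#(N/Ψ_nN) = #(N/pN)` for all `n ≥ n₁`** (`N` finite: `ω_n N = 0` and `Ψ_n ≡ p (mod ω_n)` make `Ψ_n` act as `p`). [cite: Washington1997, §13.3 (Thm. 13.13: ν)]
[cite: NeukirchSchmidtWingberg2008, (5.3.17)] -/
theorem exists_forall_natCard_quotient_cyclotomicLayer_eq [Finite N] :
    ∃ n₁ : ℕ, ∀ n, n₁ ≤ n →
      (Ideal.span {(((Polynomial.cyclotomic (p ^ (n + 1)) ℤ_[p]).comp (Polynomial.X + 1) : ℤ_[p][X]) : IwasawaAlgebra p)} • ⊤ : Submodule (IwasawaAlgebra p) N) =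
        Ideal.span {(PowerSeries.C (p : ℤ_[p]) : IwasawaAlgebra p)} • ⊤ ∧
      Nat.card (N ⧸ (Ideal.span {(((Polynomial.cyclotomic (p ^ (n + 1)) ℤ_[p]).comp (Polynomial.X + 1) : ℤ_[p][X]) : IwasawaAlgebra p)} • ⊤ :
        Submodule (IwasawaAlgebra p) N)) = Nat.card (N ⧸ (Ideal.span {(PowerSeries.C (p : ℤ_[p]) : IwasawaAlgebra p)} • ⊤ : Submodule (IwasawaAlgebra p) N)) := by
  obtain ⟨n₁, hn₁⟩ := exists_forall_omega_smul_eq_zero (p := p) (N := N)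
  refine ⟨n₁, fun n hn ↦ ?_⟩
  -- `Ψ_n • x = p • x` on `N`
  have hact : ∀ x : N, (((Polynomial.cyclotomic (p ^ (n + 1)) ℤ_[p]).comp (Polynomial.X + 1) : ℤ_[p][X]) : IwasawaAlgebra p) • x =
      (PowerSeries.C (p : ℤ_[p]) : IwasawaAlgebra p) • x := by
    intro x
    obtain ⟨c, hc⟩ := Ideal.mem_span_singleton'.mp (coe_cyclotomicLayer_sub_C_mem_span_omega (p := p) n)
    have e : (((Polynomial.cyclotomic (p ^ (n + 1)) ℤ_[p]).comp (Polynomial.X + 1) : ℤ_[p][X]) : IwasawaAlgebra p) =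
        PowerSeries.C (p : ℤ_[p]) + c * (((1 + PowerSeries.X : PowerSeries ℤ_[p]) ^ (p ^ n) - 1 : IwasawaAlgebra p)) := by
      rw [hc]; ring
    rw [e, add_smul, mul_smul, hn₁ n hn x, smul_zero, add_zero]
  have hsub : (Ideal.span {(((Polynomial.cyclotomic (p ^ (n + 1)) ℤ_[p]).comp (Polynomial.X + 1) : ℤ_[p][X]) : IwasawaAlgebra p)} • ⊤ :
      Submodule (IwasawaAlgebra p) N) = Ideal.span {(PowerSeries.C (p : ℤ_[p]) : IwasawaAlgebra p)} • ⊤ := by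
    rw [Submodule.ideal_span_singleton_smul, Submodule.ideal_span_singleton_smul]
    ext x
    simp only [Submodule.mem_smul_pointwise_iff_exists, Submodule.mem_top, true_and, hact]
  exact ⟨hsub, by rw [Nat.card_congr (Submodule.quotEquivOfEq _ _ hsub).toEquiv]⟩

end FiniteModule

/-! ## §2 The layer index of a general module is eventually `p^{pⁿ(p−1)μ + λ} · #(F/pF)` -/

section Module

variable {p : ℕ} [hp : Fact p.Prime] {M : Type u} [AddCommGroup M] [Module (IwasawaAlgebra p) M]

/-- ★★★ **IWASAWA'S `ν` IN INDEX FORM.** `X` ANY finitely generated torsion `Λ`-module, `char_Λ X = (f)`, `F ≤ X` finite with `X/F` free of finite submodules (the largest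
finite submodule). Then there is `n₁` with, for EVERY `n ≥ n₁`: **`#(X/Ψ_n X) = p^{pⁿ(p−1)·μ(f) + λ(f)} · #(F/pF)`** — the finite submodule contributes the CONSTANT
factor `#(F/pF) = p^{dim F/pF}` to every late descent number. [cite: Washington1997, §13.3 (Thm. 13.13)] [cite: NeukirchSchmidtWingberg2008, (5.3.17)] -/
theorem exists_forall_natCard_layerQuotient_eq_pow_mul_natCard_quotient_p [Module.Finite (IwasawaAlgebra p) M] (hM : Module.IsTorsion (IwasawaAlgebra p) M)
    (F : Submodule (IwasawaAlgebra p) M) [Finite F] (hF : ∀ N' : Submodule (IwasawaAlgebra p) (M ⧸ F), Finite N' → N' = ⊥) {f : IwasawaAlgebra p}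
    (hchar : Literature.NumberTheory.EllipticCurves.Module.charIdeal (IwasawaAlgebra p) M = Ideal.span {f}) :
    ∃ n₁ : ℕ, ∀ n, n₁ ≤ n →
      Nat.card (M ⧸ (Ideal.span {(((Polynomial.cyclotomic (p ^ (n + 1)) ℤ_[p]).comp (Polynomial.X + 1) : ℤ_[p][X]) : IwasawaAlgebra p)} • ⊤ :
        Submodule (IwasawaAlgebra p) M)) =
        p ^ (p ^ n * (p - 1) * mu f + lam f) * Nat.card (F ⧸ (Ideal.span {(PowerSeries.C (p : ℤ_[p]) : IwasawaAlgebra p)} • ⊤ : Submodule (IwasawaAlgebra p) F)) := by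
  obtain ⟨n₁, hn₁⟩ := exists_forall_natCard_quotient_cyclotomicLayer_eq (p := p) (N := F)
  refine ⟨max n₁ (lam f + 1), fun n hn ↦ ?_⟩
  have hlam : lam f < p ^ n * (p - 1) := by
    have h1 : n < p ^ n := Nat.lt_pow_self hp.out.one_lt
    have h2 : p ^ n ≤ p ^ n * (p - 1) := Nat.le_mul_of_pos_right _ (by have := hp.out.two_le; omega)
    have h3 : lam f + 1 ≤ n := (le_max_right _ _).trans hn
    omega
  rw [natCard_layerQuotient_eq_pow_mul hM F hF hchar hlam, (hn₁ n ((le_max_left _ _).trans hn)).2]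

/-- ★★ **FOR `μ = 0` THE DESCENT NUMBERS ARE EVENTUALLY CONSTANT: `#(X/Ψ_n X) = p^{λ(f)} · #(F/pF)` for all `n ≥ n₁`.** [cite: Washington1997, §13.3 (Thm. 13.13)]
[cite: GreenbergLNM1716, Conj. 1.11 and Prop. 4.14–4.15] -/
theorem exists_forall_natCard_layerQuotient_eq_of_mu_eq_zero [Module.Finite (IwasawaAlgebra p) M] (hM : Module.IsTorsion (IwasawaAlgebra p) M)
    (F : Submodule (IwasawaAlgebra p) M) [Finite F] (hF : ∀ N' : Submodule (IwasawaAlgebra p) (M ⧸ F), Finite N' → N' = ⊥) {f : IwasawaAlgebra p}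
    (hchar : Literature.NumberTheory.EllipticCurves.Module.charIdeal (IwasawaAlgebra p) M = Ideal.span {f}) (hμ : mu f = 0) :
    ∃ n₁ : ℕ, ∀ n, n₁ ≤ n →
      Nat.card (M ⧸ (Ideal.span {(((Polynomial.cyclotomic (p ^ (n + 1)) ℤ_[p]).comp (Polynomial.X + 1) : ℤ_[p][X]) : IwasawaAlgebra p)} • ⊤ :
        Submodule (IwasawaAlgebra p) M)) =
        p ^ lam f * Nat.card (F ⧸ (Ideal.span {(PowerSeries.C (p : ℤ_[p]) : IwasawaAlgebra p)} • ⊤ : Submodule (IwasawaAlgebra p) F)) := by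
  obtain ⟨n₁, hn₁⟩ := exists_forall_natCard_layerQuotient_eq_pow_mul_natCard_quotient_p hM F hF hchar
  exact ⟨n₁, fun n hn ↦ by rw [hn₁ n hn, hμ, mul_zero, zero_add]⟩

end Module

/-! ## §3 Selmer currency -/

section Selmer

variable {K : Type u} [Field K] [NumberField K] (W : WeierstrassCurve K) {p : ℕ} [hp : Fact p.Prime] (κ : ZpExtension K p)
  {γ : Field.absoluteGaloisGroup K}

/-- ★★ **THE RELATIVE-NORM KERNELS STABILISE.** Dual datum `D` with `X` f.g. torsion, `char_Λ X = (f)`, `F ≤ X` finite with `X/F` free of finite submodules: there is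
`n₁` with **`#ker(N_n | Sel_{p^∞}(E/K_∞)) = p^{pⁿ(p−1)μ(f) + λ(f)} · #(F/pF)` for all `n ≥ n₁`**; for `μ(f) = 0` the kernels are eventually CONSTANT of order
`p^{λ}·#(F/pF)`. [cite: GreenbergLNM1716, §1 pp. 60–65] [cite: Washington1997, §13.3 (Thm. 13.13)] -/
theorem exists_forall_natCard_endInvariants_relNorm_eq (hγ : κ.IsTopGenerator γ) (D : W.SelmerDualData κ γ) [Module.Finite (IwasawaAlgebra p) D.X]
    (hD : D.IsTorsion) (F : Submodule (IwasawaAlgebra p) D.X) [Finite F] (hF : ∀ N' : Submodule (IwasawaAlgebra p) (D.X ⧸ F), Finite N' → N' = ⊥)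
    {f : IwasawaAlgebra p} (hchar : D.charIdeal = Ideal.span {f}) :
    ∃ n₁ : ℕ, ∀ n, n₁ ≤ n →
      Nat.card ↥(endInvariants (∑ i ∈ Finset.range p, ((W.conjSelmerInfty κ γ) ^ (p ^ n)) ^ i)) =
        p ^ (p ^ n * (p - 1) * mu f + lam f) * Nat.card (F ⧸ (Ideal.span {(PowerSeries.C (p : ℤ_[p]) : IwasawaAlgebra p)} • ⊤ : Submodule (IwasawaAlgebra p) F)) ∧
      (mu f = 0 → Nat.card ↥(endInvariants (∑ i ∈ Finset.range p, ((W.conjSelmerInfty κ γ) ^ (p ^ n)) ^ i)) =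
        p ^ lam f * Nat.card (F ⧸ (Ideal.span {(PowerSeries.C (p : ℤ_[p]) : IwasawaAlgebra p)} • ⊤ : Submodule (IwasawaAlgebra p) F))) := by
  obtain ⟨n₁, hn₁⟩ := exists_forall_natCard_layerQuotient_eq_pow_mul_natCard_quotient_p (M := D.X) hD F hF hchar
  refine ⟨n₁, fun n hn ↦ ?_⟩
  rw [← natCard_layerQuotient_cyclotomic_eq_natCard_endInvariants W κ hγ D n, hn₁ n hn]
  exact ⟨rfl, fun hμ ↦ by rw [hμ, mul_zero, zero_add]⟩

end Selmer

end Summit.BirchSwinnertonDyer.BirchSwinnertonDyer.Theorems.AlignedTransportAtTwoHalfDescentLayerIndexEventual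

end
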